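import Mathlib
import Literature.NumberTheory.LFunctions.Zhang2022.Section16TwoFactorStar
import HarnessLib

/-!
# Zhang (2022) §16 Lemma 16.2 (row G-d57-1), the `2`-factor at `s = 1` for `χ(2) = −1`:
# `N₂(½)·Σ_e ϖ₂ⱼ(2^e)(ν∗χ)(2^e)2^{−e} = 9/16 + O(α)` (WP09-PLAN §10.3 D-2e, last branch)

Topic `Literature/NumberTheory/LFunctions/Zhang2022` (Landau–Siegel audit tree; verdict-neutral).
Y. Zhang, *Discrete mean estimates and the Landau–Siegel zero*, arXiv:2211.02515v1 (2022)
[Zhang2022LandauSiegel] — **an unrefereed manuscript under adjudication; nothing here asserts or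
denies its Theorems 1–2 or anything about Landau–Siegel zeros.** ZHANG-L discharge lane, WP16
BLOCK D (Lemma 16.2; carve of record: zl-w09-p6 = "the prime 2"). The branch `χ(2) = −1` (so `2 ∤ D`,
normaliser `F*₂ = G₀₀ = F₂(1,1;1−β_j) ≈ 4/3`, target value `(1−¼)/frakpFactor χ 2 = (3/4)/(4/3) = 9/16`),
by the method of `Section16TwoFactorStar`: the coefficients `u_e = ϖ₂ⱼ(2^e)(ν∗χ)(2^e)` obey the
recurrence of `N(y) = (1−y)²(1−zy)(1+y)(1+zy)²` (`z = 2^{β_j}`; `(ν∗χ)(2^e) = (−1)^e(⌊e/2⌋+1)`), so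
`N(½)·Σ_e u_e ½^e` is finite algebra in `G_{ab} = F₂(2^a,2^b;1−β_j)`, `λ₂(2) = (2+w)/3`
(`w = 2^{−β₁}`) and `z`; the closed forms (`calM2Factor_prime_eq`, `v = −1`) give the EXACT identity
`(1−z/2)(1+z/2)·G₀₀·(Φ₂(½) − 9/16) = (w−1)(−11z/32 + 3z²/32 + z³/16) + (z−1)(−7/16 + 3z/32 + z²/16)`
(`twoFactor_minus_eq`; coefficients found by exact rational arithmetic, verified by `ring`), whence
`‖Φ₂(½) − 9/16‖ ≤ 32α` for large `D` under (A) (`twoFactor_value_minus`; `|G₀₀| ≥ ½` is zl-w09-p4's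
`Lemma162R.half_le_norm_calM2Factor_one_one_small`).

Theorem-only; no definitions, no new facts.

## References

* Y. Zhang, arXiv:2211.02515v1 (2022), §16 Lemma 16.2 p. 94; App. A p. 105.
  [cite: Zhang2022LandauSiegel, §16 Lemma 16.2 p.94; App. A p.105]
-/

noncomputable section

open Complex Real Finset

namespace Literature.NumberTheory.LFunctions.Zhang2022.Typed.Section16B

open Literature.NumberTheory.LFunctions.Zhang2022
open Literature.NumberTheory.LFunctions.Zhang2022.Skeleton
open Literature.NumberTheory.LFunctions.Zhang2022.Typed.Section16A

variable (c' : ℝ) {D : ℕ} (χ : DirichletCharacter ℂ D)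

/-- `S_{m+r}(t) = S_m(t) + t^m Σ_{i<r} t^i` for the geometric block `S_m(t) = Σ_{1≤a<m} t^a` (`m ≥ 1`).
[folklore] -/
private theorem sum_Ico_pow_shift' (t : ℂ) {m : ℕ} (hm : 1 ≤ m) (r : ℕ) :
    ∑ a ∈ Finset.Ico 1 (m + r), t ^ a =
      ∑ a ∈ Finset.Ico 1 m, t ^ a + t ^ m * ∑ i ∈ Finset.range r, t ^ i := by
  induction r with
  | zero => simp
  | succ r ih =>
    rw [← Nat.add_assoc, Finset.sum_Ico_succ_top (by omega : 1 ≤ m + r), ih, Finset.sum_range_succ,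
      pow_add]
    ring

/-! ## The coefficient formula for `χ(2) = −1` -/

/-- **`G₀₀·ϖ₂ⱼ(2^e) = (−1)^e·(G₀₁ + λ₂(2)G₁₁S_e(−z) + λ₂(2)G₁₀(−z)^e)` for `e ≥ 1` when `χ(2) = −1`**
(`F*₂ = G₀₀ = F₂(1,1;1−β_j)`, `χ(2^b) = (−1)^b`, `z = 2^{β_j}`, `S_e(t) = Σ_{1≤a<e} t^a`).
[cite: Zhang2022LandauSiegel, §16 p.93 (u030)] -/
theorem G00_mul_varpi2_two_pow_of_apply_eq_neg_one (hv : χ (2 : ZMod D) = -1) (j : ℕ)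
    (hstar : calM2star c' χ (1 - betaJ c' D j) ≠ 0)
    (hG0 : calM2Factor c' χ 2 1 1 (1 - betaJ c' D j) ≠ 0) {e : ℕ} (he : 1 ≤ e) :
    calM2Factor c' χ 2 1 1 (1 - betaJ c' D j) * varpi2 c' χ j (2 ^ e) =
      (-1) ^ e * (calM2Factor c' χ 2 1 2 (1 - betaJ c' D j) +
        lam2 c' χ 2 1 * calM2Factor c' χ 2 2 2 (1 - betaJ c' D j) *
          (∑ a ∈ Finset.Ico 1 e, (-(2 : ℂ) ^ betaJ c' D j) ^ a) +
        lam2 c' χ 2 1 * calM2Factor c' χ 2 2 1 (1 - betaJ c' D j) * (-(2 : ℂ) ^ betaJ c' D j) ^ e) := by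
  classical
  set s : ℂ := 1 - betaJ c' D j with hs
  set z : ℂ := (2 : ℂ) ^ betaJ c' D j with hz
  have hs0 : 0 < s.re := by simp [hs, betaJ_re_eq_zero c' D j]
  have hv' : χ ((2 : ℕ) : ZMod D) = -1 := by exact_mod_cast hv
  have hne1 : χ (2 : ZMod D) ≠ 1 := by rw [hv]; norm_num
  have hF : χ (2 : ZMod D) ≠ 1 → calM2Factor c' χ 2 1 1 s ≠ 0 := fun _ => hG0
  have hchi : ∀ b : ℕ, χ ((2 ^ b : ℕ) : ZMod D) = (-1) ^ b := fun b => by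
    rw [Nat.cast_pow, map_pow, hv']
  have hzpow : ∀ a : ℕ, ((2 ^ a : ℕ) : ℂ) ^ betaJ c' D j = z ^ a := fun a => by
    induction a with
    | zero => simp
    | succ n ih => rw [pow_succ, Nat.cast_mul, Complex.natCast_mul_natCast_cpow, ih, hz, pow_succ]; norm_num
  have hG01 : ∀ b : ℕ, 1 ≤ b → calM2Factor c' χ 2 1 (2 ^ b) s = calM2Factor c' χ 2 1 2 s := fun b hb =>
    Section16CalM2Euler.calM2Factor_congr c' χ Nat.prime_two hs0 Iff.rfl
      ⟨fun _ => dvd_rfl, fun _ => dvd_pow_self 2 (by omega)⟩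
  have hG10 : ∀ a : ℕ, 1 ≤ a → calM2Factor c' χ 2 (2 ^ a) 1 s = calM2Factor c' χ 2 2 1 s := fun a ha =>
    Section16CalM2Euler.calM2Factor_congr c' χ Nat.prime_two hs0
      ⟨fun _ => dvd_rfl, fun _ => dvd_pow_self 2 (by omega)⟩ Iff.rfl
  have hG11 : ∀ a b : ℕ, 1 ≤ a → 1 ≤ b →
      calM2Factor c' χ 2 (2 ^ a) (2 ^ b) s = calM2Factor c' χ 2 2 2 s := fun a b ha hb =>
    Section16CalM2Euler.calM2Factor_congr c' χ Nat.prime_two hs0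
      ⟨fun _ => dvd_rfl, fun _ => dvd_pow_self 2 (by omega)⟩
      ⟨fun _ => dvd_rfl, fun _ => dvd_pow_self 2 (by omega)⟩
  have hlam : ∀ a : ℕ, 1 ≤ a → lam2 c' χ (2 ^ a) 1 = lam2 c' χ 2 1 := fun a ha => by
    rw [Lemma162R.lam2_prime_pow c' χ Nat.prime_two a 1, if_neg (by omega)]
  have hl1 : lam2 c' χ 1 1 = 1 := by
    have h := Lemma162R.lam2_prime_pow c' χ Nat.prime_two 0 1
    rwa [pow_zero, if_pos rfl] at h
  -- D-2b and the normaliser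
  rw [varpi2_two_pow c' χ j e hstar hF, if_pos hne1, ← mul_assoc, mul_inv_cancel₀ hG0, one_mul,
    Nat.sum_divisorsAntidiagonal (f := fun d l => lam2 c' χ d 1 * (d : ℂ) ^ betaJ c' D j *
      χ (l : ZMod D) * calM2Factor c' χ 2 d l s),
    Nat.divisors_prime_pow Nat.prime_two, Finset.sum_map]
  simp only [Function.Embedding.coeFn_mk]
  -- signs: `(−1)^{e−a} = (−1)^e (−1)^a`
  have hsign : ∀ a : ℕ, a ≤ e → ((-1 : ℂ)) ^ (e - a) = (-1) ^ e * (-1) ^ a := by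
    intro a ha
    have h1 : ((-1 : ℂ)) ^ (e - a) * (-1) ^ a = (-1) ^ e := by rw [← pow_add, Nat.sub_add_cancel ha]
    have h2 : ((-1 : ℂ)) ^ a * (-1) ^ a = 1 := by rw [← mul_pow]; norm_num
    calc ((-1 : ℂ)) ^ (e - a) = (-1) ^ (e - a) * ((-1) ^ a * (-1) ^ a) := by rw [h2, mul_one]
      _ = (-1) ^ e * (-1) ^ a := by rw [← mul_assoc, h1]
  have hterm : ∀ a ∈ Finset.range (e + 1),
      lam2 c' χ (2 ^ a) 1 * ((2 ^ a : ℕ) : ℂ) ^ betaJ c' D j * χ ((2 ^ e / 2 ^ a : ℕ) : ZMod D) *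
          calM2Factor c' χ 2 (2 ^ a) (2 ^ e / 2 ^ a) s =
        (-1) ^ e * (lam2 c' χ (2 ^ a) 1 * (-z) ^ a * calM2Factor c' χ 2 (2 ^ a) (2 ^ (e - a)) s) := by
    intro a ha
    have ha' : a ≤ e := Nat.lt_succ_iff.mp (Finset.mem_range.mp ha)
    rw [Nat.pow_div ha' (by norm_num), hchi, hzpow, hsign a ha', neg_pow z a]
    ring
  rw [Finset.sum_congr rfl hterm, ← Finset.mul_sum]
  congr 1
  rw [Finset.sum_range_succ, Finset.range_eq_Ico, Finset.sum_eq_sum_Ico_succ_bot (by omega : 0 < e)]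
  rw [pow_zero, Nat.sub_zero, pow_zero, mul_one, Nat.sub_self, pow_zero, hl1, one_mul, hG01 e he,
    hlam e he, hG10 e he]
  have hmid : ∑ a ∈ Finset.Ico (0 + 1) e, lam2 c' χ (2 ^ a) 1 * (-z) ^ a * calM2Factor c' χ 2 (2 ^ a) (2 ^ (e - a)) s =
      lam2 c' χ 2 1 * calM2Factor c' χ 2 2 2 s * ∑ a ∈ Finset.Ico 1 e, (-z) ^ a := by
    rw [zero_add, Finset.mul_sum]
    refine Finset.sum_congr rfl fun a ha => ?_
    obtain ⟨ha1, hae⟩ := Finset.mem_Ico.mp ha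
    rw [hlam a ha1, hG11 a (e - a) ha1 (by omega)]
    ring
  rw [hmid]
  ring

/-! ## Summability and the finite identity -/

/-- Summability of the `2`-factor series at `y = ½` (`χ(2) = −1`: `|(ν∗χ)(2^e)| = ⌊e/2⌋+1 ≤ e+1`).
[cite: Zhang2022LandauSiegel, §16 Lemma 16.2 p.94] -/
theorem summable_twoFactor_series_minus (hv : χ (2 : ZMod D) = -1) (j : ℕ) {B : ℝ}
    (hB : ∀ e : ℕ, ‖varpi2 c' χ j (2 ^ e)‖ ≤ B * ((e : ℝ) + 1)) :
    Summable fun e : ℕ =>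
      varpi2 c' χ j (2 ^ e) * nuConvChi χ (2 ^ e) * ((2 : ℂ) ^ (-(1 : ℂ))) ^ e := by
  have hv' : χ ((2 : ℕ) : ZMod D) = -1 := by exact_mod_cast hv
  have hB0 : 0 ≤ B := by
    have h := hB 0
    have : (0 : ℝ) ≤ ‖varpi2 c' χ j (2 ^ 0)‖ := norm_nonneg _
    nlinarith
  have hy : ‖(2 : ℂ) ^ (-(1 : ℂ))‖ = 1 / 2 := by
    rw [Complex.cpow_neg_one, norm_inv, Complex.norm_ofNat]; norm_num
  have hg0 : Summable fun n : ℕ => ((n : ℝ)) ^ 2 * (1 / 2 : ℝ) ^ n :=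
    summable_pow_mul_geometric_of_norm_lt_one 2 (by rw [Real.norm_eq_abs, abs_of_pos (by norm_num)]; norm_num)
  have hg1 : Summable fun e : ℕ => (((e + 1 : ℕ) : ℝ)) ^ 2 * (1 / 2 : ℝ) ^ (e + 1) :=
    (summable_nat_add_iff 1).mpr hg0
  have hg : Summable fun e : ℕ => B * (((e : ℝ) + 1) ^ 2 * (1 / 2 : ℝ) ^ e) := by
    refine ((hg1.mul_left 2).mul_left B).congr fun e => ?_
    push_cast
    ring
  refine Summable.of_norm_bounded hg fun e => ?_
  rw [norm_mul, norm_mul, norm_pow, hy, nuConvChi_prime_pow_of_apply_eq_neg_one χ Nat.prime_two hv' e,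
    norm_mul, norm_pow, norm_neg, norm_one, one_pow, one_mul]
  have hc : ‖(((e / 2 : ℕ) : ℂ) + 1)‖ ≤ (e : ℝ) + 1 := by
    rw [show (((e / 2 : ℕ) : ℂ) + 1) = (((e / 2 + 1 : ℕ) : ℝ) : ℂ) by push_cast; ring, Complex.norm_real,
      Real.norm_eq_abs, abs_of_nonneg (by positivity)]
    have : (e / 2 + 1 : ℕ) ≤ e + 1 := by omega
    exact_mod_cast this
  have he1 : (0 : ℝ) ≤ (e : ℝ) + 1 := by positivity
  calc ‖varpi2 c' χ j (2 ^ e)‖ * ‖(((e / 2 : ℕ) : ℂ) + 1)‖ * (1 / 2 : ℝ) ^ e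
      ≤ (B * ((e : ℝ) + 1)) * ((e : ℝ) + 1) * (1 / 2 : ℝ) ^ e := by
        apply mul_le_mul_of_nonneg_right _ (by positivity)
        exact mul_le_mul (hB e) hc (norm_nonneg _) (by positivity)
    _ = B * (((e : ℝ) + 1) ^ 2 * (1 / 2 : ℝ) ^ e) := by ring

/-- **The `2`-factor at `s = 1` is finite algebra (`χ(2) = −1`)**: with `y = ½`, `z = 2^{β_j}`,
`u_e = ϖ₂ⱼ(2^e)(ν∗χ)(2^e)` and `N(y) = (1−y)²(1−zy)(1+y)(1+zy)² = Σ_{k≤6} N_k y^k`,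
`N(½)·Σ_e u_e ½^e = Σ_{n≤6} (Σ_{k≤n} N_k u_{n−k}) ½^n`. [cite: Zhang2022LandauSiegel, §16 Lemma 16.2 p.94; App. A p.105] -/
theorem twoFactor_minus_finite (hv : χ (2 : ZMod D) = -1) (j : ℕ)
    (hstar : calM2star c' χ (1 - betaJ c' D j) ≠ 0)
    (hG0 : calM2Factor c' χ 2 1 1 (1 - betaJ c' D j) ≠ 0) {B : ℝ}
    (hB : ∀ e : ℕ, ‖varpi2 c' χ j (2 ^ e)‖ ≤ B * ((e : ℝ) + 1)) :
    ((1 - (2 : ℂ) ^ (-(1 : ℂ))) ^ 2 * (1 - (2 : ℂ) ^ betaJ c' D j * (2 : ℂ) ^ (-(1 : ℂ))) *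
        (1 + (2 : ℂ) ^ (-(1 : ℂ))) * (1 + (2 : ℂ) ^ betaJ c' D j * (2 : ℂ) ^ (-(1 : ℂ))) ^ 2) *
        (∑' e : ℕ, varpi2 c' χ j (2 ^ e) * nuConvChi χ (2 ^ e) * ((2 : ℂ) ^ (-(1 : ℂ))) ^ e) =
      ∑ n ∈ Finset.range 7,
        (∑ k ∈ Finset.range 7,
          (if k ≤ n then
            (if k = 0 then (1 : ℂ) else if k = 1 then (2 : ℂ) ^ betaJ c' D j - 1
              else if k = 2 then -((2 : ℂ) ^ betaJ c' D j) ^ 2 - (2 : ℂ) ^ betaJ c' D j - 1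
              else if k = 3 then -((2 : ℂ) ^ betaJ c' D j) ^ 3 + ((2 : ℂ) ^ betaJ c' D j) ^ 2 -
                (2 : ℂ) ^ betaJ c' D j + 1
              else if k = 4 then ((2 : ℂ) ^ betaJ c' D j) ^ 3 + ((2 : ℂ) ^ betaJ c' D j) ^ 2 +
                (2 : ℂ) ^ betaJ c' D j
              else if k = 5 then ((2 : ℂ) ^ betaJ c' D j) ^ 3 - ((2 : ℂ) ^ betaJ c' D j) ^ 2
              else -((2 : ℂ) ^ betaJ c' D j) ^ 3) *
              (varpi2 c' χ j (2 ^ (n - k)) * nuConvChi χ (2 ^ (n - k)))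
          else 0)) * ((2 : ℂ) ^ (-(1 : ℂ))) ^ n := by
  classical
  set y : ℂ := (2 : ℂ) ^ (-(1 : ℂ)) with hy
  set z : ℂ := (2 : ℂ) ^ betaJ c' D j with hz
  set N : ℕ → ℂ := fun k => if k = 0 then (1 : ℂ) else if k = 1 then z - 1
      else if k = 2 then -z ^ 2 - z - 1 else if k = 3 then -z ^ 3 + z ^ 2 - z + 1
      else if k = 4 then z ^ 3 + z ^ 2 + z else if k = 5 then z ^ 3 - z ^ 2
      else -z ^ 3 with hN
  set u : ℕ → ℂ := fun e => varpi2 c' χ j (2 ^ e) * nuConvChi χ (2 ^ e) with hu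
  have hv' : χ ((2 : ℕ) : ZMod D) = -1 := by exact_mod_cast hv
  have hpoly : (1 - y) ^ 2 * (1 - z * y) * (1 + y) * (1 + z * y) ^ 2 =
      ∑ k ∈ Finset.range 7, N k * y ^ k := by
    simp only [hN, Finset.sum_range_succ, Finset.sum_range_zero]
    norm_num
    ring
  have hsum : Summable fun e => u e * y ^ e := summable_twoFactor_series_minus c' χ hv j hB
  have hrec : ∀ n, 7 ≤ n →
      ∑ k ∈ Finset.range (6 + 1), (if k ≤ n then N k * u (n - k) else 0) = 0 := by
    intro n hn
    obtain ⟨m, rfl⟩ : ∃ m, n = m + 1 + 6 := ⟨n - 7, by omega⟩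
    have hm : 1 ≤ m + 1 := by omega
    set G : ℂ := calM2Factor c' χ 2 1 1 (1 - betaJ c' D j) with hG
    set A : ℂ := calM2Factor c' χ 2 1 2 (1 - betaJ c' D j) with hA
    set Bc : ℂ := lam2 c' χ 2 1 * calM2Factor c' χ 2 2 1 (1 - betaJ c' D j) with hBc
    set C : ℂ := lam2 c' χ 2 1 * calM2Factor c' χ 2 2 2 (1 - betaJ c' D j) with hC
    set S : ℂ := ∑ a ∈ Finset.Ico 1 (m + 1), (-z) ^ a with hS
    set Z : ℂ := (-z) ^ (m + 1) with hZ
    -- `u_{m+1+r} = G⁻¹ (⌊(m+1+r)/2⌋ + 1)(A + C(S + Z Σ_{i<r}(−z)^i) + Bc Z (−z)^r)`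
    have hur : ∀ r : ℕ, u (m + 1 + r) =
        G⁻¹ * (A + C * (S + Z * ∑ i ∈ Finset.range r, (-z) ^ i) + Bc * (Z * (-z) ^ r)) *
          ((((m + 1 + r) / 2 : ℕ) : ℂ) + 1) := by
      intro r
      have h2 := G00_mul_varpi2_two_pow_of_apply_eq_neg_one c' χ hv j hstar hG0 (e := m + 1 + r) (by omega)
      have hw : varpi2 c' χ j (2 ^ (m + 1 + r)) =
          G⁻¹ * ((-1) ^ (m + 1 + r) * (A + C * (S + Z * ∑ i ∈ Finset.range r, (-z) ^ i) +
            Bc * (Z * (-z) ^ r))) := by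
        rw [hA, hC, hBc, hS, hZ, ← sum_Ico_pow_shift' (-z) hm r, ← pow_add, hG]
        rw [eq_inv_mul_iff_mul_eq₀ hG0]
        linear_combination h2
      rw [hu]; dsimp only
      rw [hw, nuConvChi_prime_pow_of_apply_eq_neg_one χ Nat.prime_two hv' (m + 1 + r)]
      have hsq : ((-1 : ℂ)) ^ (m + 1 + r) * (-1) ^ (m + 1 + r) = 1 := by rw [← mul_pow]; norm_num
      linear_combination (G⁻¹ * (A + C * (S + Z * ∑ i ∈ Finset.range r, (-z) ^ i) + Bc * (Z * (-z) ^ r)) *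
        ((((m + 1 + r) / 2 : ℕ) : ℂ) + 1)) * hsq
    have hk : ∀ k ∈ Finset.range (6 + 1),
        (if k ≤ m + 1 + 6 then N k * u (m + 1 + 6 - k) else 0) = N k * u (m + 1 + 6 - k) := by
      intro k hk
      rw [if_pos (by have := Finset.mem_range.mp hk; omega)]
    rw [Finset.sum_congr rfl hk]
    simp only [Finset.sum_range_succ, Finset.sum_range_zero, zero_add]
    rw [show m + 1 + 6 - 0 = m + 1 + 6 by omega, show m + 1 + 6 - 1 = m + 1 + 5 by omega,
      show m + 1 + 6 - 2 = m + 1 + 4 by omega, show m + 1 + 6 - 3 = m + 1 + 3 by omega,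
      show m + 1 + 6 - 4 = m + 1 + 2 by omega, show m + 1 + 6 - 5 = m + 1 + 1 by omega,
      show m + 1 + 6 - 6 = m + 1 + 0 by omega,
      hur 6, hur 5, hur 4, hur 3, hur 2, hur 1, hur 0]
    -- parity of `m`: evaluate the floors before expanding
    rcases Nat.even_or_odd m with ⟨t, rfl⟩ | ⟨t, rfl⟩
    · rw [show (t + t + 1 + 6) / 2 = t + 3 by omega, show (t + t + 1 + 5) / 2 = t + 3 by omega,
        show (t + t + 1 + 4) / 2 = t + 2 by omega, show (t + t + 1 + 3) / 2 = t + 2 by omega,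
        show (t + t + 1 + 2) / 2 = t + 1 by omega, show (t + t + 1 + 1) / 2 = t + 1 by omega,
        show (t + t + 1 + 0) / 2 = t by omega]
      simp only [hN, Finset.sum_range_succ, Finset.sum_range_zero]
      norm_num
      ring
    · rw [show (2 * t + 1 + 1 + 6) / 2 = t + 4 by omega, show (2 * t + 1 + 1 + 5) / 2 = t + 3 by omega,
        show (2 * t + 1 + 1 + 4) / 2 = t + 3 by omega, show (2 * t + 1 + 1 + 3) / 2 = t + 2 by omega,
        show (2 * t + 1 + 1 + 2) / 2 = t + 2 by omega, show (2 * t + 1 + 1 + 1) / 2 = t + 1 by omega,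
        show (2 * t + 1 + 1 + 0) / 2 = t + 1 by omega]
      simp only [hN, Finset.sum_range_succ, Finset.sum_range_zero]
      norm_num
      ring
  have key := poly_mul_tsum_eq_sum_of_recurrence hsum N 6 7 hrec
  rw [hpoly]
  rw [key]


/-! ## The value in closed form and the `O(α)` bound (`χ(2) = −1`) -/

/-- **The `2`-factor at `s = 1` in closed form (`χ(2) = −1`)**: with `z = 2^{β_j}`, `w = 2^{−β₁}`,
`G₀₀ = F₂(1,1;1−β_j)`:
`(1−z/2)(1+z/2)·G₀₀·(N₂(½)·Σ_e ϖ₂ⱼ(2^e)(ν∗χ)(2^e)2^{−e} − 9/16)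
   = (w−1)(−11z/32 + 3z²/32 + z³/16) + (z−1)(−7/16 + 3z/32 + z²/16)`
(exact; the coefficients were found by exact rational arithmetic and are certified here by `ring`).
[cite: Zhang2022LandauSiegel, §16 Lemma 16.2 p.94; App. A p.105] -/
theorem twoFactor_minus_eq (hv : χ (2 : ZMod D) = -1) (j : ℕ)
    (hstar : calM2star c' χ (1 - betaJ c' D j) ≠ 0)
    (hG0 : calM2Factor c' χ 2 1 1 (1 - betaJ c' D j) ≠ 0) {B : ℝ}
    (hB : ∀ e : ℕ, ‖varpi2 c' χ j (2 ^ e)‖ ≤ B * ((e : ℝ) + 1)) :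
    (1 - (2 : ℂ) ^ betaJ c' D j / 2) * (1 + (2 : ℂ) ^ betaJ c' D j / 2) *
        calM2Factor c' χ 2 1 1 (1 - betaJ c' D j) *
      (((1 - (2 : ℂ) ^ (-(1 : ℂ))) ^ 2 * (1 - (2 : ℂ) ^ betaJ c' D j * (2 : ℂ) ^ (-(1 : ℂ))) *
          (1 + (2 : ℂ) ^ (-(1 : ℂ))) * (1 + (2 : ℂ) ^ betaJ c' D j * (2 : ℂ) ^ (-(1 : ℂ))) ^ 2) *
          (∑' e : ℕ, varpi2 c' χ j (2 ^ e) * nuConvChi χ (2 ^ e) * ((2 : ℂ) ^ (-(1 : ℂ))) ^ e) -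
        9 / 16) =
      ((2 : ℂ) ^ (-beta1 c' D) - 1) *
          (-11 * (2 : ℂ) ^ betaJ c' D j / 32 + 3 * ((2 : ℂ) ^ betaJ c' D j) ^ 2 / 32 +
            ((2 : ℂ) ^ betaJ c' D j) ^ 3 / 16) +
        ((2 : ℂ) ^ betaJ c' D j - 1) *
          (-7 / 16 + 3 * (2 : ℂ) ^ betaJ c' D j / 32 + ((2 : ℂ) ^ betaJ c' D j) ^ 2 / 16) := by
  classical
  rw [twoFactor_minus_finite c' χ hv j hstar hG0 hB]
  set s : ℂ := 1 - betaJ c' D j with hs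
  set z : ℂ := (2 : ℂ) ^ betaJ c' D j with hz
  set w : ℂ := (2 : ℂ) ^ (-beta1 c' D) with hw
  have hv' : χ ((2 : ℕ) : ZMod D) = -1 := by exact_mod_cast hv
  have hne1 : χ (2 : ZMod D) ≠ 1 := by rw [hv]; norm_num
  have hs0 : 0 < s.re := by simp [hs, betaJ_re_eq_zero c' D j]
  have hznorm : ‖z‖ = 1 := by
    rw [hz, show (2 : ℂ) = ((2 : ℕ) : ℂ) by norm_num,
      Complex.norm_natCast_cpow_of_pos (by norm_num : 0 < 2), betaJ_re_eq_zero c' D j, Real.rpow_zero]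
  have hwnorm : ‖w‖ = 1 := by
    obtain ⟨h, -⟩ := AppendixA.norm_cpow_neg_beta1 c' (D := D) (q := 2) (by norm_num)
    rw [hw, show (2 : ℂ) = ((2 : ℕ) : ℂ) by norm_num]; exact h
  have hne_of_norm : ∀ {t : ℂ} {c : ℝ}, ‖t‖ = c → c < 1 → (1 : ℂ) - t ≠ 0 := by
    intro t c ht hc h
    have : t = 1 := by linear_combination -h
    rw [this, norm_one] at ht
    linarith
  have hne_of_norm' : ∀ {t : ℂ} {c : ℝ}, ‖t‖ = c → c < 1 → (1 : ℂ) + t ≠ 0 := by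
    intro t c ht hc h
    have : t = -1 := by linear_combination h
    rw [this, norm_neg, norm_one] at ht
    linarith
  have h1x : (1 : ℂ) - z / 2 ≠ 0 :=
    hne_of_norm (by rw [norm_div, hznorm, Complex.norm_ofNat]) (by norm_num)
  have h1x' : (1 : ℂ) + z / 2 ≠ 0 :=
    hne_of_norm' (by rw [norm_div, hznorm, Complex.norm_ofNat]) (by norm_num)
  have h1wx : (1 : ℂ) - w * (z / 2) ≠ 0 :=
    hne_of_norm (by rw [norm_mul, norm_div, hwnorm, hznorm, Complex.norm_ofNat]) (by norm_num)
  have h1w2 : (1 : ℂ) + w * ((1 : ℂ) / 2) ≠ 0 :=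
    hne_of_norm' (by rw [norm_mul, hwnorm, norm_div, norm_one, Complex.norm_ofNat]) (by norm_num)
  have h2z : (2 : ℂ) - z ≠ 0 := by
    intro h; apply h1x; linear_combination h / 2
  have h2z' : (2 : ℂ) + z ≠ 0 := by
    intro h; apply h1x'; linear_combination h / 2
  have h2wz : (2 : ℂ) - w * z ≠ 0 := by
    intro h; apply h1wx; linear_combination h / 2
  have h2w : (2 : ℂ) + w ≠ 0 := by
    intro h; apply h1w2; linear_combination h / 2
  -- `x = 2^{−s} = z/2`
  have hxz : ((2 : ℕ) : ℂ) ^ (-s) = z / 2 := by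
    rw [Nat.cast_ofNat, hs, neg_sub, Complex.cpow_sub _ _ two_ne_zero, Complex.cpow_one, hz]
  have hx1 : ‖((2 : ℕ) : ℂ) ^ (-s)‖ < 1 := by
    rw [hxz, norm_div, hznorm, Complex.norm_ofNat]; norm_num
  have hxz' : (2 : ℂ) ^ (-s) = z / 2 := by
    have h := hxz; rwa [Nat.cast_ofNat] at h
  -- closed forms
  have hcop1 : Nat.Coprime 2 1 := by decide
  have hcop2 : ¬ Nat.Coprime 2 2 := by decide
  have hG00 := calM2Factor_prime_eq c' χ Nat.prime_two 1 1 s hx1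
  have hG01 := calM2Factor_prime_eq c' χ Nat.prime_two 1 2 s hx1
  have hG10 := calM2Factor_prime_eq c' χ Nat.prime_two 2 1 s hx1
  have hG11 := calM2Factor_prime_eq c' χ Nat.prime_two 2 2 s hx1
  simp only [if_pos hcop1, if_neg hcop2, Nat.cast_ofNat, AppendixA.locPref, AppendixA.locLam]
    at hG00 hG01 hG10 hG11
  rw [hxz', hv, ← hw] at hG00 hG01 hG10 hG11
  norm_num at hG00 hG01 hG10 hG11
  -- non-vanishing of the denominators in the shapes `field_simp` meets
  have e1 : (1 : ℂ) + w * (1 / 2) ≠ 0 := h1w2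
  have e2 : (1 : ℂ) + z / 2 ≠ 0 := h1x'
  have e3 : (1 : ℂ) + w / 2 ≠ 0 := by intro h; apply h1w2; linear_combination h
  have e4 : (2 : ℂ) + w ≠ 0 := h2w
  have e5 : (2 : ℂ) + z ≠ 0 := h2z'
  have e6 : (2 : ℂ) - z * w ≠ 0 := by intro h; apply h2wz; linear_combination h
  have e7 : (1 : ℂ) - z * w / 2 ≠ 0 := by intro h; apply h1wx; linear_combination h
  have e8 : (1 : ℂ) - w * z / 2 ≠ 0 := by intro h; apply h1wx; linear_combination h
  have e9 : w + 2 ≠ (0 : ℂ) := by intro h; apply h2w; linear_combination h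
  have e10 : z + 2 ≠ (0 : ℂ) := by intro h; apply h2z'; linear_combination h
  have hLam : lam2 c' χ 2 1 = (1 + w / 2) / (1 + 1 / 2) := by
    rw [Typed.Section16ALeaves.lam2_prime c' χ Nat.prime_two 1, hv']
    push_cast
    rw [neg_add, Complex.cpow_add _ _ two_ne_zero, Complex.cpow_neg_one, ← hw]
    ring
  -- the normaliser in closed form is non-zero (it is `G₀₀`)
  have hG0' := hG0
  rw [hG00] at hG0'
  -- the seven coefficients
  have hF : χ (2 : ZMod D) ≠ 1 → calM2Factor c' χ 2 1 1 s ≠ 0 := fun _ => hG0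
  have hl1 : lam2 c' χ 1 1 = 1 := by
    have h := Lemma162R.lam2_prime_pow c' χ Nat.prime_two 0 1
    rwa [pow_zero, if_pos rfl] at h
  have hu0 : varpi2 c' χ j 1 * nuConvChi χ 1 = 1 := by
    have h := varpi2_two_pow c' χ j 0 hstar hF
    rw [pow_zero, if_pos hne1] at h
    rw [Lemma162R.nuConvChi_one, mul_one, h]
    simp only [Nat.divisorsAntidiagonal_one, Finset.sum_singleton, Nat.cast_one, map_one,
      Complex.one_cpow, mul_one, hl1, one_mul]
    exact inv_mul_cancel₀ hG0
  have hur : ∀ r : ℕ, varpi2 c' χ j (2 ^ (1 + r)) * nuConvChi χ (2 ^ (1 + r)) =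
      (calM2Factor c' χ 2 1 1 s)⁻¹ * (calM2Factor c' χ 2 1 2 s +
        lam2 c' χ 2 1 * calM2Factor c' χ 2 2 2 s * ((-z) * ∑ i ∈ Finset.range r, (-z) ^ i) +
        lam2 c' χ 2 1 * calM2Factor c' χ 2 2 1 s * (-z) ^ (1 + r)) *
        ((((1 + r) / 2 : ℕ) : ℂ) + 1) := by
    intro r
    have h2 := G00_mul_varpi2_two_pow_of_apply_eq_neg_one c' χ hv j hstar hG0 (e := 1 + r) (by omega)
    rw [sum_Ico_pow_shift' (-z) (le_refl 1) r, Finset.Ico_self, Finset.sum_empty, zero_add, pow_one] at h2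
    rw [← hz, ← hs] at h2
    have hw' : varpi2 c' χ j (2 ^ (1 + r)) = (calM2Factor c' χ 2 1 1 s)⁻¹ * ((-1) ^ (1 + r) *
        (calM2Factor c' χ 2 1 2 s +
          lam2 c' χ 2 1 * calM2Factor c' χ 2 2 2 s * ((-z) * ∑ i ∈ Finset.range r, (-z) ^ i) +
          lam2 c' χ 2 1 * calM2Factor c' χ 2 2 1 s * (-z) ^ (1 + r))) := by
      rw [eq_inv_mul_iff_mul_eq₀ hG0]; exact h2
    rw [hw', nuConvChi_prime_pow_of_apply_eq_neg_one χ Nat.prime_two hv' (1 + r)]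
    have hsq : ((-1 : ℂ)) ^ (1 + r) * (-1) ^ (1 + r) = 1 := by rw [← mul_pow]; norm_num
    linear_combination ((calM2Factor c' χ 2 1 1 s)⁻¹ * (calM2Factor c' χ 2 1 2 s +
        lam2 c' χ 2 1 * calM2Factor c' χ 2 2 2 s * ((-z) * ∑ i ∈ Finset.range r, (-z) ^ i) +
        lam2 c' χ 2 1 * calM2Factor c' χ 2 2 1 s * (-z) ^ (1 + r)) *
        ((((1 + r) / 2 : ℕ) : ℂ) + 1)) * hsq
  have hu1 := hur 0
  have hu2 := hur 1
  have hu3 := hur 2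
  have hu4 := hur 3
  have hu5 := hur 4
  have hu6 := hur 5
  norm_num [Finset.sum_range_succ] at hu1 hu2 hu3 hu4 hu5 hu6
  simp only [Finset.sum_range_succ, Finset.sum_range_zero, zero_add]
  norm_num
  rw [hu0, hu1, hu2, hu3, hu4, hu5, hu6, hG01, hG10, hG11, hLam, Complex.cpow_neg_one]
  -- first cancel the normaliser `G₀₀ · G₀₀⁻¹` symbolically, then substitute its closed form
  field_simp
  rw [hG00]
  field_simp
  ring

/-- `𝓛 ≥ M` once `D ≥ ⌈exp M⌉₊`. [cite: Zhang2022LandauSiegel, §2 (2.1)] -/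
private theorem le_ell_of_ceil_exp_le_minus {M : ℝ} {D : ℕ} (hD : ⌈Real.exp M⌉₊ ≤ D) : M ≤ ell D := by
  have hDexp : Real.exp M ≤ D := le_trans (Nat.le_ceil _) (by exact_mod_cast hD)
  have hDpos : (0 : ℝ) < D := lt_of_lt_of_le (Real.exp_pos _) hDexp
  rw [ell]; exact (Real.le_log_iff_exp_le hDpos).mpr hDexp

/-- `‖n^w − 1‖ ≤ ‖w‖·log n` for a purely imaginary `w` and `n ≥ 1`. [folklore] -/
private theorem norm_natCast_cpow_sub_one_le_im₃ {n : ℕ} (hn : 0 < n) {w : ℂ} (hw : w.re = 0) :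
    ‖(n : ℂ) ^ w - 1‖ ≤ ‖w‖ * Real.log n := by
  have hn0 : (n : ℂ) ≠ 0 := by exact_mod_cast hn.ne'
  have him : w = ((w.im : ℝ) : ℂ) * I := by
    apply Complex.ext <;> simp [hw]
  have hnorm : ‖w‖ = |w.im| := by
    rw [congrArg (fun z : ℂ => ‖z‖) him]; simp
  have e0 : (Real.log n : ℂ) * w = I * ((Real.log n * w.im : ℝ) : ℂ) := by
    apply Complex.ext <;> simp [hw]
  rw [Complex.cpow_def_of_ne_zero hn0, ← Complex.natCast_log, e0]
  calc ‖Complex.exp (I * ((Real.log n * w.im : ℝ) : ℂ)) - 1‖ ≤ ‖(Real.log n * w.im : ℝ)‖ :=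
        Real.norm_exp_I_mul_ofReal_sub_one_le
    _ = ‖w‖ * Real.log n := by
        rw [Real.norm_eq_abs, abs_mul, abs_of_nonneg (Real.log_natCast_nonneg n), mul_comm, hnorm]

/-- **D-2e, branch `χ(2) = −1`: the `2`-factor at `s = 1` is `9/16 + O(α)`** — for `D` large under (A),
`j ∈ {1,2}`: `‖N₂(½)·Σ_e ϖ₂ⱼ(2^e)(ν∗χ)(2^e)2^{−e} − 9/16‖ ≤ 32α` (`|2^{−β₁}−1| ≤ 2α`,
`|2^{β_j}−1| ≤ 5α`, `|1∓z/2| ≥ ½`, `|G₀₀| ≥ ½`). [cite: Zhang2022LandauSiegel, §16 Lemma 16.2 p.94] -/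
theorem twoFactor_value_minus (c' : ℝ) : ForAllLarge fun D _ χ => AssumptionA D χ →
    χ (2 : ZMod D) = -1 → ∀ j ∈ ({1, 2} : Finset ℕ),
      ‖((1 - (2 : ℂ) ^ (-(1 : ℂ))) ^ 2 * (1 - (2 : ℂ) ^ betaJ c' D j * (2 : ℂ) ^ (-(1 : ℂ))) *
          (1 + (2 : ℂ) ^ (-(1 : ℂ))) * (1 + (2 : ℂ) ^ betaJ c' D j * (2 : ℂ) ^ (-(1 : ℂ))) ^ 2) *
          (∑' e : ℕ, varpi2 c' χ j (2 ^ e) * nuConvChi χ (2 ^ e) * ((2 : ℂ) ^ (-(1 : ℂ))) ^ e) -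
        9 / 16‖ ≤ 32 * alpha D := by
  obtain ⟨D₁, hD₁⟩ := two_data_ne_zero c'
  obtain ⟨B, D₂, hD₂⟩ := norm_varpi2_two_pow_le c'
  refine ForAllLarge.of_le (max (max D₁ D₂) ⌈Real.exp (Real.pi * (5 * |c'| + 1) + 4)⌉₊)
    fun D _ χ hD hq hprim hA hv j hj => ?_
  have hDD₁ : D₁ ≤ D := le_trans (le_trans (le_max_left _ _) (le_max_left _ _)) hD
  have hDD₂ : D₂ ≤ D := le_trans (le_trans (le_max_right _ _) (le_max_left _ _)) hD
  have hℓ : Real.pi * (5 * |c'| + 1) + 4 ≤ ell D :=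
    le_ell_of_ceil_exp_le_minus (le_trans (le_max_right _ _) hD)
  have hπ3 := Real.pi_gt_three
  have hπ4 := Real.pi_lt_four
  have hℓ4 : 4 ≤ ell D := by nlinarith [abs_nonneg c', Real.pi_pos]
  have hℓ2 : 2 ≤ ell D := by linarith
  have hℓπ : Real.pi * (5 * |c'| + 1) ≤ ell D := by linarith
  have hne1 : χ (2 : ZMod D) ≠ 1 := by rw [hv]; norm_num
  obtain ⟨hstar, hF⟩ := hD₁ D χ hDD₁ hq hprim hA j hj
  have hG0 := hF hne1
  have hB := hD₂ D χ hDD₂ hq hprim hA j hj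
  set z : ℂ := (2 : ℂ) ^ betaJ c' D j with hz
  set w : ℂ := (2 : ℂ) ^ (-beta1 c' D) with hw
  have hid := twoFactor_minus_eq c' χ hv j hstar hG0 hB
  rw [← hz, ← hw] at hid
  -- sizes
  have hα : alpha D = Real.pi / ell D ^ 9 := by rw [alpha, bigP, Real.log_exp]
  have hα0 : 0 < alpha D := by rw [hα]; positivity
  have hlog2 : Real.log 2 ≤ 1 := by have := Real.log_two_lt_d9; linarith
  have hlog2' : 0 ≤ Real.log 2 := Real.log_nonneg (by norm_num)
  have hβj : ‖betaJ c' D j‖ < 5 * alpha D := norm_betaJ_lt_five_alpha hℓ2 hℓπ hj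
  have hznorm : ‖z‖ = 1 := by
    rw [hz, show (2 : ℂ) = ((2 : ℕ) : ℂ) by norm_num,
      Complex.norm_natCast_cpow_of_pos (by norm_num : 0 < 2), betaJ_re_eq_zero c' D j, Real.rpow_zero]
  have hz1 : ‖z - 1‖ ≤ 5 * alpha D := by
    have h := norm_natCast_cpow_sub_one_le_im₃ (n := 2) (by norm_num) (w := betaJ c' D j)
      (betaJ_re_eq_zero c' D j)
    rw [Nat.cast_ofNat] at h
    calc ‖z - 1‖ ≤ ‖betaJ c' D j‖ * Real.log 2 := h
      _ ≤ (5 * alpha D) * 1 := mul_le_mul hβj.le hlog2 hlog2' (by positivity)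
      _ = 5 * alpha D := by ring
  have hαℓ : alpha D * ell D * (5 * |c'| + 1) ≤ 1 := by
    have hℓ1 : 1 ≤ ell D := by linarith
    have h8 : ell D ≤ ell D ^ 8 := le_self_pow₀ hℓ1 (by norm_num)
    have hpos : 0 < ell D ^ 9 := by positivity
    have e9 : ell D ^ 9 = ell D ^ 8 * ell D := by ring
    rw [hα, div_mul_eq_mul_div, div_mul_eq_mul_div, div_le_iff₀ hpos, one_mul, e9]
    calc Real.pi * ell D * (5 * |c'| + 1) = (Real.pi * (5 * |c'| + 1)) * ell D := by ring
      _ ≤ ell D * ell D := by gcongr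
      _ ≤ ell D ^ 8 * ell D := by gcongr
  have hb1 : |b1 c' D| ≤ 2 * alpha D := by
    rw [b1, abs_mul, abs_of_pos hα0]
    have hc : |5 * c' * alpha D * ell D| ≤ 1 := by
      rw [show 5 * c' * alpha D * ell D = c' * (5 * (alpha D * ell D)) by ring, abs_mul,
        abs_of_pos (by positivity : 0 < 5 * (alpha D * ell D))]
      nlinarith [abs_nonneg c', hα0, (show 0 < ell D by linarith)]
    have : |1 - 5 * c' * alpha D * ell D| ≤ 2 := by
      calc |1 - 5 * c' * alpha D * ell D| ≤ |(1 : ℝ)| + |5 * c' * alpha D * ell D| := abs_sub _ _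
        _ ≤ 1 + 1 := by rw [abs_one]; linarith
        _ = 2 := by norm_num
    nlinarith [abs_nonneg (1 - 5 * c' * alpha D * ell D)]
  have hw1 : ‖w - 1‖ ≤ 2 * alpha D := by
    obtain ⟨-, h⟩ := AppendixA.norm_cpow_neg_beta1 c' (D := D) (q := 2) (by norm_num)
    rw [Nat.cast_ofNat] at h
    calc ‖w - 1‖ ≤ |b1 c' D| * Real.log 2 := h
      _ ≤ (2 * alpha D) * 1 := mul_le_mul hb1 hlog2 hlog2' (by positivity)
      _ = 2 * alpha D := by ring
  -- `α ≤ 1/50000`, so the smallness hypotheses of the lower bound `|G₀₀| ≥ 1/2` hold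
  have hαs : alpha D ≤ 1 / 50000 := by
    rw [hα, div_le_iff₀ (by positivity)]
    have h9 : (4 : ℝ) ^ 9 ≤ ell D ^ 9 := pow_le_pow_left₀ (by norm_num) hℓ4 9
    nlinarith
  have hb1' : |b1 c' D| ≤ 1 / 10000 := by linarith
  have hβj' : ‖betaJ c' D j‖ ≤ 1 / 10000 := by linarith
  have hGhalf : 1 / 2 ≤ ‖calM2Factor c' χ 2 1 1 (1 - betaJ c' D j)‖ :=
    Lemma162R.half_le_norm_calM2Factor_one_one_small c' χ Nat.prime_two (by norm_num)
      (fun _ => hne1) hq hb1' hβj' (j := j)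
  have h1x : 1 / 2 ≤ ‖1 - z / 2‖ := by
    have := norm_sub_norm_le (1 : ℂ) (z / 2)
    rw [norm_one, norm_div, hznorm, Complex.norm_ofNat] at this
    linarith
  have h1x' : 1 / 2 ≤ ‖1 + z / 2‖ := by
    have := norm_sub_norm_le (1 : ℂ) (-(z / 2))
    rw [norm_one, norm_neg, norm_div, hznorm, Complex.norm_ofNat, sub_neg_eq_add] at this
    linarith
  -- the numerator polynomials
  have hA1 : ‖-11 * z / 32 + 3 * z ^ 2 / 32 + z ^ 3 / 16‖ ≤ 1 / 2 := by
    have a1 := norm_add_le (-11 * z / 32 + 3 * z ^ 2 / 32) (z ^ 3 / 16)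
    have a2 := norm_add_le (-11 * z / 32) (3 * z ^ 2 / 32)
    have n1 : ‖-11 * z / 32‖ = 11 / 32 := by
      rw [norm_div, norm_mul, norm_neg, hznorm, Complex.norm_ofNat, Complex.norm_ofNat]; norm_num
    have n2 : ‖3 * z ^ 2 / 32‖ = 3 / 32 := by
      rw [norm_div, norm_mul, norm_pow, hznorm, Complex.norm_ofNat, Complex.norm_ofNat]; norm_num
    have n3 : ‖z ^ 3 / 16‖ = 1 / 16 := by
      rw [norm_div, norm_pow, hznorm, Complex.norm_ofNat]; norm_num
    linarith
  have hA2 : ‖-7 / 16 + 3 * z / 32 + z ^ 2 / 16‖ ≤ 19 / 32 := by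
    have a1 := norm_add_le (-7 / 16 + 3 * z / 32) (z ^ 2 / 16)
    have a2 := norm_add_le (-7 / 16 : ℂ) (3 * z / 32)
    have n1 : ‖(-7 / 16 : ℂ)‖ = 7 / 16 := by
      rw [norm_div, norm_neg, Complex.norm_ofNat, Complex.norm_ofNat]
    have n2 : ‖3 * z / 32‖ = 3 / 32 := by
      rw [norm_div, norm_mul, hznorm, Complex.norm_ofNat, Complex.norm_ofNat]; norm_num
    have n3 : ‖z ^ 2 / 16‖ = 1 / 16 := by
      rw [norm_div, norm_pow, hznorm, Complex.norm_ofNat]; norm_num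
    linarith
  -- assemble: `|LHS factor| · |Φ − 9/16| = |numerator| ≤ α + 5α·19/32`
  have hnum : ‖(w - 1) * (-11 * z / 32 + 3 * z ^ 2 / 32 + z ^ 3 / 16) +
      (z - 1) * (-7 / 16 + 3 * z / 32 + z ^ 2 / 16)‖ ≤ 4 * alpha D := by
    calc _ ≤ ‖(w - 1) * (-11 * z / 32 + 3 * z ^ 2 / 32 + z ^ 3 / 16)‖ +
          ‖(z - 1) * (-7 / 16 + 3 * z / 32 + z ^ 2 / 16)‖ := norm_add_le _ _
      _ ≤ (2 * alpha D) * (1 / 2) + (5 * alpha D) * (19 / 32) := by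
          rw [norm_mul, norm_mul]
          gcongr
      _ ≤ 4 * alpha D := by nlinarith
  have hfac : 1 / 8 ≤ ‖(1 - z / 2) * (1 + z / 2) * calM2Factor c' χ 2 1 1 (1 - betaJ c' D j)‖ := by
    rw [norm_mul, norm_mul]
    calc (1 : ℝ) / 8 = 1 / 2 * (1 / 2) * (1 / 2) := by norm_num
      _ ≤ ‖1 - z / 2‖ * ‖1 + z / 2‖ * ‖calM2Factor c' χ 2 1 1 (1 - betaJ c' D j)‖ := by
          gcongr
  have hprod := congrArg (fun t : ℂ => ‖t‖) hid
  simp only [norm_mul] at hprod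
  -- `|fac|·|Φ − 9/16| ≤ 4α` and `|fac| ≥ 1/8`
  set Φ := ‖((1 - (2 : ℂ) ^ (-(1 : ℂ))) ^ 2 * (1 - z * (2 : ℂ) ^ (-(1 : ℂ))) *
          (1 + (2 : ℂ) ^ (-(1 : ℂ))) * (1 + z * (2 : ℂ) ^ (-(1 : ℂ))) ^ 2) *
          (∑' e : ℕ, varpi2 c' χ j (2 ^ e) * nuConvChi χ (2 ^ e) * ((2 : ℂ) ^ (-(1 : ℂ))) ^ e) -
        9 / 16‖ with hΦ
  have hkey : ‖1 - z / 2‖ * ‖1 + z / 2‖ * ‖calM2Factor c' χ 2 1 1 (1 - betaJ c' D j)‖ * Φ ≤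
      4 * alpha D := by
    rw [hprod]; exact hnum
  rw [norm_mul, norm_mul] at hfac
  have hΦ0 : 0 ≤ Φ := norm_nonneg _
  nlinarith

end Literature.NumberTheory.LFunctions.Zhang2022.Typed.Section16B

end
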